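import Summits.QuantumFields.YangMills.Theorems.UnitScaleTiltFluctuationComparisonRegPrRepAtHeightsCoreRowsFamUpper
import Summits.QuantumFields.YangMills.Theorems.UnitScaleTiltFluctuationComparisonRegPrRepAtHeightsSocketOnPrintChi
import Summits.QuantumFields.YangMills.Theorems.AlphaInputsT3ACv4Chi
import HarnessLib

/-!
# `UnitScaleTiltFluctuationComparisonRegPrRepAtHeightsChiV4Fam` — THE v4 TWIN (★★OWNER RULING g26-№14 (F-2), BILL §7 P22 «20520 side») of `…RepAtHeightsChiV3Fam` (p568228):
# THE v4 χ-RECORD'S FAMILY DATUM `AlphaInputsT3AC.dataOfV4chi p π` (`p : ∀ K, PkgAtV4Chi F 𝔠 γ hγ hγ1 K`), ITS LOWER ONE-STEP TRIVIAL ENVELOPE **ON PRINT'S χ** FROM THE ROW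
# `StepAlphaV3ChiAC.fibre57LowOn` (unchanged step package), AND CONJUNCT (A) ON PRINT'S χ — `PrintChi.TwoSidedRepOn F γ b₀ p₀ (atHeights (printChiSets (dataOfV4chi p π) b₀ p₀)) ε₀ …`
# (★r1 g2's socket `twoSidedRepOn_of_oneStepTrivOn_printChi`, p546995) — what the record-free §2 engine `InteriorExcision.regPrIntL_of_dataOnPrintChi` (p550585) consumes
# (crux `FluctuationComparisonRegPrIntL`, stmt-QuantumFields-20520, skeleton v5kC → v5kD; cell ym3-torus, width seat ym-ust-20520-w2 g4)

Count-neutral helper (`--supports stmt-QuantumFields-20520`).  WHY A TWIN.  The v3 χ-package `PkgAtV3Chi` carries `run : RunAlphaV3ChiAC`, whose comb (67)-row `hLF67` at margin 0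
was LOCATED unsuppliable by print's map at the frozen selection (19936 evidence #60); RULING g26-№14 replaces it ADDITIVELY by the currency-free (71)-row (`AlphaV4AC.RunAlphaV4ChiAC`,
`AlphaInputsT3ACv4Lane`/`…v4Chi`, ★alpha-2 g7).  Nothing in the v3 original reads `hLF67`: the datum is the rows datum of the projected family `fun K ↦ (p K).toRows`
(`…RepAtHeightsCoreRowsFam`), the χ-step row `(run.steps k hk).fibre57LowOn` and the seven χ-free leaves `stepResidualsV3Core_of_alpha … (run.steps k hk).toStepAlphaV3CoreAC` are
read VERBATIM; every proof below is `…RepAtHeightsChiV3Fam`'s with `PkgAtV3Chi ↦ PkgAtV4Chi`, `toCore ↦ toRows`, `dataOfCoreV3 ↦ dataOfCoreRows`.  The v3 file stays in the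
tree unchanged.  Nothing of [Balaban1985UV3] is asserted; CONDITIONAL on the family `p` (data carrying its rows).  YM₃ on T³ is rung R3 of the programme, not the Clay problem.

References: T. Bałaban, CMP 102 (1985) 255–275 [Balaban1985UV3] ((7) p.257, (37) p.265, (41)–(42) p.266, (47) p.267, (71) p.273, p.272); CMP 102 (1985) 277–309
[Balaban1985Variational] (Thm 1 (8) p.279).
-/

set_option autoImplicit false

noncomputable section

namespace Summit.QuantumFields.YangMills.Theorems

open MeasureTheory Filter
open Literature.MathematicalPhysics.QuantumFieldTheory.Balaban1983to89
open Literature.MathematicalPhysics.QuantumFieldTheory.Balaban1983to89.AveragingRT (rnTransport)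
open Literature.MathematicalPhysics.QuantumFieldTheory.Balaban1983to89.B10
open Literature.MathematicalPhysics.QuantumFieldTheory.Balaban1983to89.B10SectAGathering
open Literature.MathematicalPhysics.QuantumFieldTheory.Balaban1983to89.T3ContinuumYM3Torus
open Literature.MathematicalPhysics.QuantumFieldTheory.Balaban1983to89.T3UnitLawDensityEML (ℰp rt)
open Literature.MathematicalPhysics.QuantumFieldTheory.Balaban1983to89.T3UnitScaleTilt (θBal)
open Literature.MathematicalPhysics.QuantumFieldTheory.Balaban1983to89.T3LevelShift (fieldShift)
open Literature.MathematicalPhysics.QuantumFieldTheory.Balaban1983to89.T3PrintedRegularMinimiser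
open Literature.MathematicalPhysics.QuantumFieldTheory.Balaban1983to89.T3AlphaInputsAC
open Literature.MathematicalPhysics.QuantumFieldTheory.Balaban1983to89.T3AlphaInputsACTrivEnvelope
open Literature.MathematicalPhysics.QuantumFieldTheory.Balaban1983to89.Missing (boltzmann)
open Literature.MathematicalPhysics.QuantumFieldTheory.Balaban1985CMP102
open Literature.MathematicalPhysics.QuantumFieldTheory.Balaban1985CMP102.Setting
open Summit.QuantumFields.Balaban3D.Carriers
open Summit.QuantumFields.Balaban3D.Proofs.Primitives
open Summit.QuantumFields.Balaban3D.Proofs.TowerAC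
open Summit.QuantumFields.Balaban3D.Proofs.StandardAC
open Summit.QuantumFields.Balaban3D.Proofs.InputsAC
open Summit.QuantumFields.Balaban3D.Proofs.TowerFactsAC
open Summit.QuantumFields.Balaban3D.Proofs.Bound55AC
open Summit.QuantumFields.Balaban3D.Proofs.Thm2AC
open Summit.QuantumFields.Balaban3D.Proofs (Bound55Std.measurable_actionEta Bound55Std.actionEta_nonneg)
open Summit.QuantumFields.YangMills.Theorems.LogComparisonRepAtHeights
open Summit.QuantumFields.YangMills.Theorems.LogComparisonRepAtHeightsOn
open Summit.QuantumFields.YangMills.Theorems.AlphaV3AC (stepResidualsV3Core_of_alpha expo47_succ_le_expo57_CoreAC)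

variable {F : T3Family} {𝔠 : AlphaConsts F.L (suGroupModel 2).N} {γ : ℝ} {hγ : 0 < γ} {hγ1 : γ ≤ (min 𝔠.gamma0 1) ^ 2}
  (p : ∀ K, AlphaInputsT3AC.PkgAtV4Chi F 𝔠 γ hγ hγ1 K) (π : AlphaInputsT3AC.PolymerT3 F)

/-! ## §1 The χ-record's family datum and print's family at the T³ objects -/

/-- **THE DATUM OF A FAMILY OF v4 χ-PACKAGES** (`dataOfV3chi`'s twin): the rows datum of the projected family `fun K ↦ (p K).toRows` — same field table as
`AlphaInputsT3AC.dataOfV3`∕`dataOfV3chi`. [cite: Balaban1985UV3, (38)–(43) p.266 and (47) p.267] -/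
abbrev AlphaInputsT3AC.dataOfV4chi : AlphaDataT3 F γ :=
  AlphaInputsT3AC.dataOfCoreRows (fun K => (p K).toRows) π

/-- **AT THE T³ OBJECTS PRINT'S VALIDITY FAMILY IS ★r1's `printChiSets`**: for `j ≤ K`, `PinnedStep.loPrintAC 𝔠.lane (p K).toRows.X j = printChiSets (dataOfV4chi p π) 𝔠.b₀ 𝔠.p₀ K j`
(`ε₁(j) = θBal(K−j)`, `U_j(triv, ·) = ukAll U_j`, window constant `1`). [cite: Balaban1985UV3, (7) p.257 and (47) p.267] -/
theorem AlphaInputsT3AC.loPrintAC_eq_printChiSets_v4 (K j : ℕ) (hj : j ≤ K) :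
    PinnedStep.loPrintAC 𝔠.lane (p K).toRows.X j = printChiSets (AlphaInputsT3AC.dataOfV4chi p π) 𝔠.b₀ 𝔠.p₀ K j := by
  have hε1 : eps1Of (T3Scales F γ hγ (hγ1.trans (sq_min_one_le _ 𝔠.gamma0_pos)) K) 𝔠.lane.carrier j = θBal F.L γ 𝔠.b₀ 𝔠.p₀ (K - j) :=
    (coreRows_towerFacts (p K).toRows j hj).1
  ext V
  rw [PinnedStep.mem_loPrintAC_iff, hε1, one_mul, ← ((p K).toRows.X).UkH_triv j]
  simp only [printChiSets]
  exact ⟨fun h => ⟨h.1, fun _ => h.2⟩, fun h => ⟨h.1, h.2 hj⟩⟩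

/-! ## §2 The lower one-step trivial envelope ON PRINT'S χ from the χ-record's row -/

/-- **THE LOWER ONE-STEP TRIVIAL ENVELOPE OF THE χ-RECORD'S DATUM, ON PRINT'S χ — PROVED FROM THE RE-TYPED ROW.**  For every run `K` and step `k < K`:
`OneStepLowerTrivOn (printChiSets (dataOfV4chi p π) b₀ p₀) (dataOfV4chi p π) K k` — a.e. on print's `χ_{k+1}`-set the (47)-minorant of level `k+1` is dominated by one
renormalisation transformation of `𝟙[χ_k-set]·`(the (47)-minorant of level `k`): the member's row `StepAlphaV3ChiAC.fibre57LowOn` (print's (47) with `χ_{k+1}` left, `χ_k` inside),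
the χ-free exponent step `AlphaV3AC.expo47_succ_le_expo57_CoreAC` over the seven leaves `stepResidualsV3Core_of_alpha`, homogeneity of the transport for `e^{E}`, and §1.
(`…V3FamBase` §4's proof with the tower's `χ` replaced by `𝟙[loPrintAC]`.) [cite: Balaban1985UV3, (37) p.265, (47) p.267 and p.272] -/
theorem AlphaInputsT3AC.dataOfV4chi_oneStepLowerTrivOnAt (K k : ℕ) (hk : k + 1 ≤ K) :
    OneStepLowerTrivOn (printChiSets (AlphaInputsT3AC.dataOfV4chi p π) 𝔠.b₀ 𝔠.p₀) (AlphaInputsT3AC.dataOfV4chi p π) K k hk := by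
  -- the package's data of run `K`, its χ-step row at `k`, the seven χ-free residual leaves, the lower exponent step
  have hle := T3Scales_window F 𝔠 γ hγ hγ1 K
  have st := (p K).run.steps k hk
  have R := stepResidualsV3Core_of_alpha hle k hk st.toStepAlphaV3CoreAC
  have hgath := fun U => expo47_succ_le_expo57_CoreAC 𝔠.lane (p K).toRows.X (p K).toRows.𝔖 k hk R U
  have h57 := st.fibre57LowOn
  obtain ⟨hU, hPm, hPb⟩ := coreRows_dataRows (p K).toRows k (by omega) (Hist.triv (F.P K) k)
  -- abbreviations in the tower's letters
  set T : TowerRun := (p K).toRows.T with hT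
  set E : ℝ := (p K).toRows.E with hE
  set P := piecesAC 𝔠.lane (p K).toRows.X (p K).toRows.𝔖 k with hP
  set S₃ := T3Scales F γ hγ (hγ1.trans (sq_min_one_le _ 𝔠.gamma0_pos)) K with hS₃
  -- print's family at levels `k`, `k+1` = the χ-sets of the datum
  have hlok : PinnedStep.loPrintAC 𝔠.lane (p K).toRows.X k = printChiSets (AlphaInputsT3AC.dataOfV4chi p π) 𝔠.b₀ 𝔠.p₀ K k :=
    AlphaInputsT3AC.loPrintAC_eq_printChiSets_v4 p π K k (by omega)
  have hlok1 : PinnedStep.loPrintAC 𝔠.lane (p K).toRows.X (k + 1) = printChiSets (AlphaInputsT3AC.dataOfV4chi p π) 𝔠.b₀ 𝔠.p₀ K (k + 1) :=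
    AlphaInputsT3AC.loPrintAC_eq_printChiSets_v4 p π K (k + 1) hk
  have hlom : MeasurableSet (PinnedStep.loPrintAC 𝔠.lane (p K).toRows.X k) :=
    PinnedStep.measurableSet_loPrintAC 𝔠.lane (p K).toRows.X k hU
  -- the integrand of the right side of `Fibre57LowOnAC` and its non-negativity / integrability
  set f : GaugeField (F.P K) k (Matrix.specialUnitaryGroup (Fin 2) ℂ) → ℝ := fun U =>
    (PinnedStep.loPrintAC 𝔠.lane (p K).toRows.X k).indicator (fun _ => (1 : ℝ)) U *
      Real.exp (-(T.mainT k (T.triv k) U) + T.Pint k (T.triv k) U - T.Ecst k - T.Rm k) with hf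
  have hi0 : ∀ U : GaugeField (F.P K) k (Matrix.specialUnitaryGroup (Fin 2) ℂ),
      0 ≤ (PinnedStep.loPrintAC 𝔠.lane (p K).toRows.X k).indicator (fun _ => (1 : ℝ)) U :=
    fun U => Set.indicator_nonneg (fun _ _ => zero_le_one) U
  have hi1 : ∀ U : GaugeField (F.P K) k (Matrix.specialUnitaryGroup (Fin 2) ℂ),
      (PinnedStep.loPrintAC 𝔠.lane (p K).toRows.X k).indicator (fun _ => (1 : ℝ)) U ≤ 1 :=
    fun U => Set.indicator_le_self' (fun _ _ => zero_le_one) U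
  have hf0 : ∀ U, 0 ≤ f U := fun U => mul_nonneg (hi0 U) (Real.exp_pos _).le
  have hmain : ∀ W : GaugeField (F.P K) k (Matrix.specialUnitaryGroup (Fin 2) ℂ),
      T.mainT k (T.triv k) W = (S₃.gk k)⁻¹ ^ 2 * S₃.actionEta k ((p K).UkH k (Hist.triv (F.P K) k) W) := fun _ => rfl
  have hfi : Integrable f (fieldMeasure (F.P K) k (Matrix.specialUnitaryGroup (Fin 2) ℂ)) := by
    refine Balaban3D.Proofs.Transport48.integrable_weight_mul_exp (P := F.P K) (G := Matrix.specialUnitaryGroup (Fin 2) ℂ)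
      (m := fun U => (PinnedStep.loPrintAC 𝔠.lane (p K).toRows.X k).indicator (fun _ => (1 : ℝ)) U) (measurable_const.indicator hlom) hi0 hi1
      (F := fun U => -(T.mainT k (T.triv k) U) + T.Pint k (T.triv k) U - T.Ecst k - T.Rm k) ?_ (c := (p K).toRows.𝔄.cP k - T.Ecst k - T.Rm k) ?_
    · simp_rw [hmain]
      exact (((measurable_const.mul ((Bound55Std.measurable_actionEta (S := S₃) k).comp hU)).neg.add hPm).sub measurable_const).sub
        measurable_const
    · intro U
      have h0 : 0 ≤ T.mainT k (T.triv k) U := by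
        rw [hmain]
        exact mul_nonneg (sq_nonneg _) (Bound55Std.actionEta_nonneg (S := S₃) k _)
      have h2 : T.Pint k (T.triv k) U ≤ (p K).toRows.𝔄.cP k := hPb U
      linarith
  -- the transport of the route: `rt F K k` IS `rnTransport` over the pinned averaging `(p.X).av k = blockAvg ℰp`
  have hkm : k + 1 ≤ F.m + K := by omega
  have hav : ((p K).toRows.X).av k = BlockAveraging.blockAvg (P := F.P K) (j := k) ℰp := avT3_of_le F K hkm
  have hrtT : ∀ g : GaugeField (F.P K) k (Matrix.specialUnitaryGroup (Fin 2) ℂ) → ℝ,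
      (rt F K k hkm).T g = rnTransport (((p K).toRows.X).av k).avg g := fun g => by
    rw [hav]; rfl
  -- the restricted lower envelope of level `k` IS `e^{E}·f`
  have hind : (printChiSets (AlphaInputsT3AC.dataOfV4chi p π) 𝔠.b₀ 𝔠.p₀ K k).indicator
      (lowerTriv (AlphaInputsT3AC.dataOfV4chi p π) K k) = fun U => Real.exp E * f U := by
    have hlow : lowerTriv (AlphaInputsT3AC.dataOfV4chi p π) K k = fun U => Real.exp E *
        ((fun _ => (1 : ℝ)) U * Real.exp (-(T.mainT k (T.triv k) U) + T.Pint k (T.triv k) U - T.Ecst k - T.Rm k)) := by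
      funext U
      rw [lowerTriv_eq_exp, one_mul]
      show Real.exp ((-(T.mainT k (T.triv k) U) + T.Pint k (T.triv k) U - (T.Ecst k - E)) - T.Rm k) =
        Real.exp E * Real.exp (-(T.mainT k (T.triv k) U) + T.Pint k (T.triv k) U - T.Ecst k - T.Rm k)
      rw [← Real.exp_add]
      congr 1
      ring
    rw [← hlok, hlow]
    funext U
    simp only [hf, Set.indicator]
    -- the two occurrences of print's family are definitionally, not syntactically, equal (`PkgAtV4Chi.toRows` projections): four cases
    split_ifs with h1 h2 h2
    · rfl
    · exact absurd h1 h2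
    · exact absurd h2 h1
    · ring
  -- homogeneity of the transport under the constant `e^{E}`
  have hhom := rnTransport_const_mul_ae (((p K).toRows.X).av k).avg f hf0 hfi (Real.exp_nonneg E)
  -- the goal
  show ∀ᵐ W ∂fieldMeasure (F.P K) (k + 1) (Matrix.specialUnitaryGroup (Fin 2) ℂ),
    W ∈ printChiSets (AlphaInputsT3AC.dataOfV4chi p π) 𝔠.b₀ 𝔠.p₀ K (k + 1) →
      lowerTriv (AlphaInputsT3AC.dataOfV4chi p π) K (k + 1) W ≤
        (rt F K k hkm).T ((printChiSets (AlphaInputsT3AC.dataOfV4chi p π) 𝔠.b₀ 𝔠.p₀ K k).indicator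
          (lowerTriv (AlphaInputsT3AC.dataOfV4chi p π) K k)) W
  rw [hind, hrtT, ← hlok1]
  filter_upwards [h57, hhom] with W h57W hhomW
  intro hWlo
  have h1 : (PinnedStep.loPrintAC 𝔠.lane (p K).toRows.X (k + 1)).indicator (fun _ => (1 : ℝ)) W = 1 := Set.indicator_of_mem hWlo _
  have hexp : lowerTriv (AlphaInputsT3AC.dataOfV4chi p π) K (k + 1) W =
      Real.exp E * Real.exp (-(T.mainT (k + 1) (T.triv (k + 1)) W) + T.Pint (k + 1) (T.triv (k + 1)) W - T.Ecst (k + 1) - T.Rm (k + 1)) := by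
    rw [lowerTriv_eq_exp]
    show Real.exp ((-(T.mainT (k + 1) (T.triv (k + 1)) W) + T.Pint (k + 1) (T.triv (k + 1)) W - (T.Ecst (k + 1) - E)) - T.Rm (k + 1)) = _
    rw [← Real.exp_add]
    congr 1
    ring
  have key : lowerTriv (AlphaInputsT3AC.dataOfV4chi p π) K (k + 1) W ≤ Real.exp E * rnTransport (((p K).toRows.X).av k).avg f W := by
    rw [hexp]
    refine mul_le_mul_of_nonneg_left ?_ (Real.exp_nonneg E)
    calc Real.exp (-(T.mainT (k + 1) (T.triv (k + 1)) W) + T.Pint (k + 1) (T.triv (k + 1)) W - T.Ecst (k + 1) - T.Rm (k + 1))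
        ≤ Real.exp (-(T.mainT (k + 1) (T.triv (k + 1)) W) - T.Ecst k
            + (P.logσ₀ + P.dg * Real.log (T.g k)) * P.starB (T.triv (k + 1)) + P.logZU (T.triv (k + 1)) W
            + P.Pold (T.triv (k + 1)) W - T.Rm k + P.logFl (T.triv (k + 1)) W) := Real.exp_le_exp.mpr (hgath W)
      _ = (PinnedStep.loPrintAC 𝔠.lane (p K).toRows.X (k + 1)).indicator (fun _ => (1 : ℝ)) W *
            Real.exp (-(T.mainT (k + 1) (T.triv (k + 1)) W) - T.Ecst k
            + (P.logσ₀ + P.dg * Real.log (T.g k)) * P.starB (T.triv (k + 1)) + P.logZU (T.triv (k + 1)) W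
            + P.Pold (T.triv (k + 1)) W - T.Rm k + P.logFl (T.triv (k + 1)) W) := by rw [h1, one_mul]
      _ ≤ rnTransport (((p K).toRows.X).av k).avg f W := h57W
  exact key.trans (le_of_eq hhomW.symm)

/-! ## §3 The trivial-envelope rows ON PRINT'S χ, bundled -/

/-- **`TrivEnvelopeRowsOn (printChiSets …)` FOR THE χ-RECORD'S DATUM**: base (parts 1), lower ON print's χ (§2), upper on the window (part 2), integrability (part 1).
[cite: Balaban1985UV3, (1) p.256, (41) p.266 and (47) p.267] -/
theorem AlphaInputsT3AC.dataOfV4chi_trivEnvelopeRowsOn :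
    TrivEnvelopeRowsOn (printChiSets (AlphaInputsT3AC.dataOfV4chi p π) 𝔠.b₀ 𝔠.p₀) (AlphaInputsT3AC.dataOfV4chi p π) 𝔠.b₀ 𝔠.p₀ :=
  ⟨AlphaInputsT3AC.dataOfCoreRows_baseTrivAt (fun K => (p K).toRows) π,
    fun K j hjK => ⟨AlphaInputsT3AC.dataOfV4chi_oneStepLowerTrivOnAt p π K j hjK,
      AlphaInputsT3AC.dataOfCoreRows_oneStepUpperTrivAt (fun K => (p K).toRows) π K j hjK⟩,
    AlphaInputsT3AC.dataOfCoreRows_trivExpIntegrable (fun K => (p K).toRows) π⟩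

/-! ## §4 Conjunct (A) ON PRINT'S χ for the χ-record's datum -/

/-- **CONJUNCT (A) ON PRINT'S χ FOR AN ARBITRARY FAMILY OF χ-PACKAGES** (the re-typed record's replacement of `repAtHeights_dataOfV3`): for every family `p` whose members carry
the given [7]-constants (`hp`) and the adapter's thresholds on the coupling, `PrintChi.TwoSidedRepOn F γ 𝔠.b₀ 𝔠.p₀ (atHeights (printChiSets (dataOfV4chi p π) 𝔠.b₀ 𝔠.p₀)) ε₀ …` —
[Balaban1985UV3] (41) ∧ (47) at the trivial history for the RESTRICTED height densities, two-sided with slack `Rm`, asserted at the data whose reading is print-χ-good — ★r1 g2's socket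
`twoSidedRepOn_of_oneStepTrivOn_printChi` fed by §3, `dataOfCoreRows_mainTermAtHeights`, `dataOfCoreRows_rmSize`, `dataOfCoreRows_measurable_uminTriv`.  This is hypothesis (b) of
`InteriorExcision.regPrIntL_of_dataOnPrintChi`'s `hData`. [cite: Balaban1985UV3, (41) p.266, (47) p.267 and Thm 2 p.272] -/
theorem AlphaInputsT3AC.twoSidedRepOnPrintChi_dataOfV4chi {a₀ a₁ : ℝ} (hp : ∀ K, (p K).a₀ = a₀ ∧ (p K).a₁ = a₁) (ε₀ : ℝ) (hε : 0 < ε₀)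
    (hhi : ε₀ ≤ a₀) (ha₁ : ∀ n, θBal F.L γ 𝔠.b₀ 𝔠.p₀ n ≤ a₁) (hlo : ∀ n, 𝔠.B₃ * θBal F.L γ 𝔠.b₀ 𝔠.p₀ n ≤ ε₀)
    (h4 : ∀ n, 4 * θBal F.L γ 𝔠.b₀ 𝔠.p₀ n < ε₀) :
    PrintChi.TwoSidedRepOn F γ 𝔠.b₀ 𝔠.p₀ (atHeights (printChiSets (AlphaInputsT3AC.dataOfV4chi p π) 𝔠.b₀ 𝔠.p₀)) ε₀
      (AlphaInputsT3AC.dataOfV4chi p π).PintH (AlphaInputsT3AC.dataOfV4chi p π).EcstH (AlphaInputsT3AC.dataOfV4chi p π).RmH :=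
  twoSidedRepOn_of_oneStepTrivOn_printChi hγ.le
    (fun K j hj => AlphaInputsT3AC.dataOfCoreRows_measurable_uminTriv (fun K => (p K).toRows) π K j hj)
    (AlphaInputsT3AC.dataOfV4chi_trivEnvelopeRowsOn p π)
    (AlphaInputsT3AC.dataOfCoreRows_mainTermAtHeights (fun K => (p K).toRows) π (fun K => hp K) ε₀ hε hhi ha₁ hlo h4)
    (AlphaInputsT3AC.dataOfCoreRows_rmSize (fun K => (p K).toRows) π)

/-- **THE `UminTrivIsRegMinimiser` CLAUSES AT HEIGHTS `n < K` FOR THE χ-RECORD'S DATUM** (hypothesis (a) of the engine's `hData`; part 1's `dataOfCoreRows_uminTriv` at the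
projected family). [cite: Balaban1985Variational, Thm 1 (8) p.279 and Prop 7 p.299] -/
theorem AlphaInputsT3AC.dataOfV4chi_uminTriv (K n : ℕ) (hnK : n < K) (ε₀ : ℝ)
    (ha₁ : θBal F.L γ 𝔠.b₀ 𝔠.p₀ n ≤ (p K).a₁) (hlo : 𝔠.B₃ * θBal F.L γ 𝔠.b₀ 𝔠.p₀ n ≤ ε₀) (hhi : ε₀ ≤ (p K).a₀)
    (V : GaugeField (F.P n) 0 (Matrix.specialUnitaryGroup (Fin 2) ℂ)) (hV : PlaqSmall (θBal F.L γ 𝔠.b₀ 𝔠.p₀ n) V) :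
    (AlphaInputsT3AC.dataOfV4chi p π).Umin K (K - n) ((AlphaInputsT3AC.dataOfV4chi p π).triv K (K - n))
        (fieldShift (F.sitesPerDir_eq (m := F.m) (K := K) (j := K - n) (m' := F.m) (K' := n) (j' := 0) (by omega)) V) ∈
      regFibrePr F n K hnK.le ε₀ V ∧
    wilsonAction4 ((AlphaInputsT3AC.dataOfV4chi p π).Umin K (K - n) ((AlphaInputsT3AC.dataOfV4chi p π).triv K (K - n))
        (fieldShift (F.sitesPerDir_eq (m := F.m) (K := K) (j := K - n) (m' := F.m) (K' := n) (j' := 0) (by omega)) V)) =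
      minActionRegPr F n K hnK.le ε₀ V :=
  AlphaInputsT3AC.dataOfCoreRows_uminTriv (fun K => (p K).toRows) π K n hnK ε₀ ha₁ hlo hhi V hV

end Summit.QuantumFields.YangMills.Theorems

end
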